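import Summits.MatrixMultiplication.MatrixMultiplication.Theorems.LevelGradedCohnUmansLevelOneGL2DesignsMultiquadraticLift
import Summits.MatrixMultiplication.MatrixMultiplication.Theorems.LevelGradedCohnUmansLevelOneGL2DesignsStubTangencySetsHermitianReduction

/-!
# Induced point–line matchings of size `q^{3/2 − ε}` over EVERY prime field (wall-breaker axis `parabola lifts
over finite fields`, stub `stub_tangencySets` of the crux `LevelOneGL2Designs`, stmt-MatrixMultiplication-14080 —
all-primes trace-zero lift, file 5: assembly)

Pohoata (arXiv:2607.20422, 2026), Thm. 1.3, gives `IM(2,q) ≳_r q^{3/2 − 2/(r−1)}` for the primes `q ≡ ±1 (mod r)`, a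
set of positive density, and records `limsup_q log IM(2,q)/log q = 3/2`.  Here the SAME exponent is reached along ALL
primes: for every `j`,

  `IM(2,q) ≥ c_j · q^{3/2 − 2^{−j}}`  for every prime `q ≥ q₀(j)`    (`exists_tangencySet_allPrimes`),

so `lim_{q prime} log IM(2,q)/log q = 3/2` (`liminf` as well as `limsup`; the upper bound `IM(2,q) ≤ q^{3/2} + q` is
`…TangencyUpperBound`).  Proof: Prop. 5.1 of the paper needs only a totally real field in which `q` has a
degree-one prime; with `ℓ_0 < … < ℓ_j` the first `j+1` primes and `σ_i = (ℓ_i | q)`, the prime `q` splits completely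
in the multiquadratic field `K_𝒮 = ℚ(√ℓ_S : S ∈ 𝒮)`, `𝒮 = {S : ∏_{i∈S} σ_i = 1}`, of degree `d = |𝒮| ≥ 2^j`
(`two_mul_card_signSet`) — one of finitely many fields, whence uniform constants.  Files 1–4 carry out Prop. 5.1 for
the order `ℤ[√ℓ_S : S ∈ 𝒮]` in explicit coordinates (trace-zero box `a_∅ = 0`, no wrap-around through the
`d × d` norm determinant, square roots in the splitting field of `∏(X² − ℓ_i)` over `𝔽_q`, Frobenius via Euler's
criterion); this file chooses `B = ⌊(q/2C₁)^{1/(2d)}⌋` and does the bookkeeping.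

* `exists_tangencySet_allPrimes` — the display above (tangency sets = induced matchings in `𝔽_q²`);
* `exists_tangencySet_allPrimes_eps` — `∀ ε > 0, ∃ c > 0, ∃ q₀, ∀ primes q ≥ q₀`: a tangency set of size
  `≥ c·q^{3/2−ε}`;
* `stubFormat_near_threeHalves_allPrimes` — the stub's exact flag format (strong representative systems,
  `u_f ⬝ᵥ v_{f'} = 1 ↔ f = f'`) with `p^{3/2}` replaced by `p^{3/2−ε}`, for EVERY sufficiently large prime `p`
  (via `FlagLine.TangencyHermitian.srs_of_tangencySet`).  The stub itself (exponent `3/2`) stays open.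

New relative to print (the all-primes / liminf statement); elementary given files 1–4.  No definitions.
-/

-- the summit/problem path `MatrixMultiplication.MatrixMultiplication` is fixed by the tree layout (D-0017)
set_option linter.dupNamespace false

noncomputable section

open Finset Matrix Polynomial

namespace Summit.MatrixMultiplication.MatrixMultiplication.Theorems.LevelOneGL2Designs.Multiquadratic

/-- **Square roots of the small primes in a finite extension of `𝔽_q`**: in the splitting field of
`∏_i (X² − ℓ_i)` over `ZMod q` every `ℓ_i` has a square root. [elementary] -/
theorem exists_roots {n : ℕ} (ℓ : Fin n → ℕ) (q : ℕ) [Fact q.Prime] :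
    ∃ t : Fin n → (∏ i : Fin n, ((X : (ZMod q)[X]) ^ 2 - C ((ℓ i : ℕ) : ZMod q))).SplittingField,
      ∀ i, t i ^ 2 = (ℓ i : (∏ i : Fin n, ((X : (ZMod q)[X]) ^ 2 - C ((ℓ i : ℕ) : ZMod q))).SplittingField) := by
  let F := (∏ i : Fin n, ((X : (ZMod q)[X]) ^ 2 - C ((ℓ i : ℕ) : ZMod q))).SplittingField
  have hsplit : Splits ((∏ i : Fin n, ((X : (ZMod q)[X]) ^ 2 - C ((ℓ i : ℕ) : ZMod q))).map
      (algebraMap (ZMod q) F)) := SplittingField.splits _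
  have hmap : (∏ i : Fin n, ((X : (ZMod q)[X]) ^ 2 - C ((ℓ i : ℕ) : ZMod q))).map (algebraMap (ZMod q) F) =
      ∏ i : Fin n, ((X : F[X]) ^ 2 - C ((ℓ i : ℕ) : F)) := by
    simp only [Polynomial.map_prod, Polynomial.map_sub, Polynomial.map_pow, Polynomial.map_X, Polynomial.map_natCast,
      Polynomial.C_eq_natCast]
  have hmonic : (∏ i : Fin n, ((X : F[X]) ^ 2 - C ((ℓ i : ℕ) : F))).Monic :=
    monic_prod_of_monic _ _ fun i _ => monic_X_pow_sub_C _ two_ne_zero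
  have hroot : ∀ i : Fin n, ∃ a : F, a ^ 2 = (ℓ i : F) := by
    intro i
    have hdvd : ((X : F[X]) ^ 2 - C ((ℓ i : ℕ) : F)) ∣ ∏ i : Fin n, ((X : F[X]) ^ 2 - C ((ℓ i : ℕ) : F)) :=
      Finset.dvd_prod_of_mem _ (Finset.mem_univ i)
    have hspl : Splits ((X : F[X]) ^ 2 - C ((ℓ i : ℕ) : F)) := by
      rw [hmap] at hsplit
      exact hsplit.of_dvd hmonic.ne_zero hdvd
    obtain ⟨a, ha⟩ := hspl.exists_eval_eq_zero (by rw [degree_X_pow_sub_C (by norm_num)]; norm_num)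
    refine ⟨a, ?_⟩
    rw [Polynomial.eval_sub, Polynomial.eval_pow, Polynomial.eval_X, Polynomial.eval_C, sub_eq_zero] at ha
    exact ha
  choose t ht using hroot
  exact ⟨t, ht⟩

/-- **Induced point–line matchings near exponent `3/2` over ALL prime fields.**  For every `j` there are `c > 0`
and `q₀` such that for every prime `q ≥ q₀` the affine plane over `ZMod q` contains a point set `V` with
`|V| ≥ c · q^{3/2 − 2^{−j}}`, every point `v` of which lies on a line `{w : u ⬝ᵥ w = u ⬝ᵥ v}` (`u ≠ 0`) meeting `V`
only in `v`.  (Pohoata's Prop. 5.1 in the multiquadratic field `ℚ(√ℓ_S : (ℓ_S|q) = 1)` built from the first `j+1`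
primes, of degree `d ∈ [2^j, 2^{j+1}]`; box `B = ⌊(q/2C₁)^{1/(2d)}⌋`, `C₁ = (2^{j+1})!·(2^{j+4}L²)^{2^{j+1}}`,
`L = ∏ℓ_i`.)  In print only for `q ≡ ±1 (mod r)` (Pohoata 2026, Thm. 1.3); the all-primes form is new.
[this programme; method of Pohoata 2026 Prop. 5.1] -/
theorem exists_tangencySet_allPrimes (j : ℕ) :
    ∃ c : ℝ, 0 < c ∧ ∃ q₀ : ℕ, ∀ q : ℕ, q.Prime → q₀ ≤ q →
      ∃ V : Finset (Fin 2 → ZMod q), c * (q : ℝ) ^ ((3 : ℝ) / 2 - 1 / 2 ^ j) ≤ V.card ∧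
        ∀ v ∈ V, ∃ u : Fin 2 → ZMod q, u ≠ 0 ∧ ∀ w ∈ V, u ⬝ᵥ w = u ⬝ᵥ v → w = v := by
  classical
  -- the primes `ℓ_0 < … < ℓ_j`
  set n : ℕ := j + 1 with hn
  set ℓ : Fin n → ℕ := fun i => Nat.nth Nat.Prime i with hℓ
  have hprime : ∀ i, (ℓ i).Prime := fun i => Nat.nth_mem_of_infinite Nat.infinite_setOf_prime i
  have hinj : Function.Injective ℓ := fun i i' h =>
    Fin.ext (Nat.nth_injective Nat.infinite_setOf_prime h)
  have hℓ1 : ∀ i, 1 ≤ ℓ i := fun i => (hprime i).one_lt.le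
  set L : ℕ := ∏ i, ℓ i with hL
  have hL1 : 1 ≤ L := Finset.one_le_prod' fun i _ => hℓ1 i
  have hℓL : ∀ i, ℓ i ≤ L := fun i => by
    have := prod_le_prod_univ ℓ hℓ1 {i}
    rwa [Finset.prod_singleton] at this
  -- constants
  set D : ℕ := 2 ^ n with hD
  set C₀ : ℕ := 2 ^ (n + 3) * L ^ 2 with hC₀
  set C₁ : ℕ := D.factorial * C₀ ^ D with hC₁
  have hC₀1 : 1 ≤ C₀ := by rw [hC₀]; exact Nat.one_le_iff_ne_zero.2 (by positivity)
  have hC₁1 : 1 ≤ C₁ := by rw [hC₁]; exact Nat.one_le_iff_ne_zero.2 (by positivity)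
  refine ⟨(((2 * C₁ : ℝ)) ^ ((3 : ℝ) / 2) * 2 ^ (D - 1))⁻¹, by positivity, 2 * C₁ + L + 3, ?_⟩
  intro q hq hq₀
  haveI hqF : Fact q.Prime := ⟨hq⟩
  have hq2 : q ≠ 2 := by omega
  have hqL : L < q := by omega
  have hq0 : (0 : ℝ) < q := by exact_mod_cast hq.pos
  -- square roots of the `ℓ_i` in a finite extension `F ⊇ 𝔽_q`
  let F := (∏ i : Fin n, ((X : (ZMod q)[X]) ^ 2 - C ((ℓ i : ℕ) : ZMod q))).SplittingField
  obtain ⟨t, ht⟩ : ∃ t : Fin n → F, ∀ i, t i ^ 2 = (ℓ i : F) := exists_roots ℓ q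
  -- the signs `σ_i = ℓ_i^{(q-1)/2} = ±1` and the subgroup `𝒮`
  set σ : Fin n → ZMod q := fun i => ((ℓ i : ℕ) : ZMod q) ^ (q / 2) with hσ
  have hℓq : ∀ i, ((ℓ i : ℕ) : ZMod q) ≠ 0 := by
    intro i h
    rw [ZMod.natCast_eq_zero_iff] at h
    have := Nat.le_of_dvd (hprime i).pos h
    have := hℓL i
    omega
  have hσpm : ∀ i, σ i = 1 ∨ σ i = -1 := fun i => ZMod.pow_div_two_eq_neg_one_or_one q (hℓq i)
  have hσ2 : ∀ i, σ i ^ 2 = 1 := fun i => by rcases hσpm i with h | h <;> simp [h]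
  set 𝒮 : Finset (Finset (Fin n)) := Finset.univ.filter fun S => ∏ i ∈ S, σ i = 1 with h𝒮def
  have h𝒮 : ∀ S, S ∈ 𝒮 ↔ ∏ i ∈ S, σ i = 1 := fun S => by simp [h𝒮def]
  have h0 : (∅ : Finset (Fin n)) ∈ 𝒮 := empty_mem_signSet h𝒮
  have hΔ := symmDiff_mem_signSet hσ2 h𝒮
  set d : ℕ := 𝒮.card with hd
  have hdD : d ≤ D := by
    rw [hd, hD]
    calc 𝒮.card ≤ (Finset.univ : Finset (Finset (Fin n))).card := Finset.card_le_univ _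
      _ = 2 ^ n := by rw [Finset.card_univ, Fintype.card_finset, Fintype.card_fin]
  have hjd : 2 ^ j ≤ d := by
    have := two_mul_card_signSet hσpm h𝒮
    have h2n : 2 ^ Fintype.card (Fin n) = 2 * 2 ^ j := by rw [Fintype.card_fin, hn, pow_succ, mul_comm]
    rw [h2n] at this
    omega
  have hd1 : 1 ≤ d := le_trans Nat.one_le_two_pow hjd
  -- the reduction `θ_S ∈ 𝔽_q` of the roots `∏_{i∈S} t_i`, `S ∈ 𝒮` (Frobenius)
  have hfrob : ∀ i, t i ^ q = algebraMap (ZMod q) F (σ i) * t i := root_pow_prime ℓ q hq2 t ht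
  have hθex : ∀ S : Finset (Fin n), ∃ b : ZMod q, S ∈ 𝒮 → algebraMap (ZMod q) F b = ∏ i ∈ S, t i := by
    intro S
    by_cases hS : S ∈ 𝒮
    · obtain ⟨b, hb⟩ := prod_root_mem_range q σ t hfrob ((h𝒮 S).1 hS)
      exact ⟨b, fun _ => hb⟩
    · exact ⟨0, fun h => absurd h hS⟩
  choose θ hθ using hθex
  -- the box size `B = ⌊x⌋`, `x = (q / 2C₁)^{1/(2d)}`
  set y : ℝ := (q : ℝ) / (2 * C₁) with hy
  have hy1 : 1 ≤ y := by
    rw [hy, le_div_iff₀ (by positivity)]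
    have : ((2 * C₁ : ℕ) : ℝ) ≤ q := by exact_mod_cast (show 2 * C₁ ≤ q by omega)
    push_cast at this; linarith
  have hy0 : 0 < y := by linarith
  set x : ℝ := y ^ (1 / (2 * d : ℝ)) with hx
  have hx0 : 0 ≤ x := Real.rpow_nonneg hy0.le _
  have hx2d : x ^ (2 * d) = y := by
    rw [hx, ← Real.rpow_natCast, ← Real.rpow_mul hy0.le]
    have : (1 / (2 * d : ℝ)) * ((2 * d : ℕ) : ℝ) = 1 := by
      have : (0 : ℝ) < d := by exact_mod_cast hd1
      push_cast; field_simp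
    rw [this, Real.rpow_one]
  set B : ℕ := ⌊x⌋₊ with hB
  have hBx : (B : ℝ) ≤ x := Nat.floor_le hx0
  have hxB : x ≤ B + 1 := (Nat.lt_floor_add_one x).le
  -- **no wrap-around numerics**: `d! · (H L)^d < q`, `H = 2^n (2B)² L + 2B²`
  have hHL : ((2 ^ Fintype.card (Fin n) * (2 * B) * (2 * B) * L + 2 * B ^ 2 : ℕ) : ℝ) * L ≤ C₀ * (B : ℝ) ^ 2 := by
    rw [Fintype.card_fin, hC₀]; push_cast
    have hL1' : (1 : ℝ) ≤ L := by exact_mod_cast hL1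
    have h2n : (1 : ℝ) ≤ 2 ^ n := one_le_pow₀ (by norm_num)
    have hT : (2 : ℝ) * (B : ℝ) ^ 2 * L ≤ 4 * 2 ^ n * (B : ℝ) ^ 2 * L ^ 2 := by
      have h1 : (1 : ℝ) ≤ 2 * 2 ^ n * L := by nlinarith
      calc (2 : ℝ) * (B : ℝ) ^ 2 * L = (2 * (B : ℝ) ^ 2 * L) * 1 := by ring
        _ ≤ (2 * (B : ℝ) ^ 2 * L) * (2 * 2 ^ n * L) := mul_le_mul_of_nonneg_left h1 (by positivity)
        _ = 4 * 2 ^ n * (B : ℝ) ^ 2 * L ^ 2 := by ring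
    have key : ((2 : ℝ) ^ n * (2 * (B : ℝ)) * (2 * (B : ℝ)) * L + 2 * (B : ℝ) ^ 2) * L =
        4 * 2 ^ n * (B : ℝ) ^ 2 * L ^ 2 + 2 * (B : ℝ) ^ 2 * L := by ring
    have key2 : (2 : ℝ) ^ (n + 3) * (L : ℝ) ^ 2 * (B : ℝ) ^ 2 =
        4 * 2 ^ n * (B : ℝ) ^ 2 * L ^ 2 + 4 * 2 ^ n * (B : ℝ) ^ 2 * L ^ 2 := by rw [pow_add]; ring
    rw [key, key2]
    linarith
  have hnum : (d.factorial : ℤ) *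
      (((2 ^ Fintype.card (Fin n) * (2 * B) * (2 * B) * L + 2 * B ^ 2 : ℕ) : ℤ) * ∏ i, (ℓ i : ℤ)) ^ d < q := by
    have hLz : (∏ i, (ℓ i : ℤ)) = (L : ℤ) := by rw [hL]; push_cast; rfl
    rw [hLz]
    have hR : (d.factorial : ℝ) * ((((2 ^ Fintype.card (Fin n) * (2 * B) * (2 * B) * L + 2 * B ^ 2 : ℕ) : ℝ)) *
        L) ^ d < q := by
      have h1 : (((2 ^ Fintype.card (Fin n) * (2 * B) * (2 * B) * L + 2 * B ^ 2 : ℕ) : ℝ) * L) ^ d ≤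
          ((C₀ : ℝ) * (B : ℝ) ^ 2) ^ d :=
        pow_le_pow_left₀ (by positivity) hHL d
      have h2 : ((C₀ : ℝ) * (B : ℝ) ^ 2) ^ d ≤ (C₀ : ℝ) ^ d * x ^ (2 * d) := by
        rw [mul_pow, pow_mul]
        gcongr
      have h3 : (d.factorial : ℝ) * (C₀ : ℝ) ^ d ≤ C₁ := by
        rw [hC₁]; push_cast
        have hdf : (d.factorial : ℝ) ≤ D.factorial := by exact_mod_cast Nat.factorial_le hdD
        have hCp : (C₀ : ℝ) ^ d ≤ (C₀ : ℝ) ^ D := pow_le_pow_right₀ (by exact_mod_cast hC₀1) hdD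
        exact mul_le_mul hdf hCp (by positivity) (by positivity)
      have hdf0 : (0 : ℝ) ≤ d.factorial := by positivity
      calc (d.factorial : ℝ) * ((((2 ^ Fintype.card (Fin n) * (2 * B) * (2 * B) * L + 2 * B ^ 2 : ℕ) : ℝ)) * L) ^ d
          ≤ (d.factorial : ℝ) * ((C₀ : ℝ) ^ d * x ^ (2 * d)) := mul_le_mul_of_nonneg_left (h1.trans h2) hdf0
        _ = ((d.factorial : ℝ) * (C₀ : ℝ) ^ d) * y := by rw [hx2d]; ring
        _ ≤ C₁ * y := mul_le_mul_of_nonneg_right h3 hy0.le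
        _ = q / 2 := by rw [hy]; field_simp
        _ < q := by linarith
    exact_mod_cast hR
  -- **the point set** of size `(2B+1)^d (2B²+1)^{d-1}`
  obtain ⟨V, hVcard, hV⟩ := exists_pointSet ℓ hprime hinj h0 hΔ t ht θ hθ B hnum
  refine ⟨V, ?_, hV⟩
  -- **counting**: `|V| ≥ x^{3d-2}/2^{d-1} ≥ c q^{3/2 - 2^{-j}}`
  have hcount : x ^ (3 * d - 2) / 2 ^ (d - 1) ≤ V.card := by
    have := Literature.Combinatorics.Extremal.Pohoata2026.count_bound d hd1 x hx0 B hxB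
    rw [mul_comm ((2 * B ^ 2 + 1) ^ (d - 1))] at this
    rw [hVcard, ← hd]
    exact_mod_cast this
  -- `x^{3d-2} = y^{3/2 - 1/d} ≥ y^{3/2 - 1/2^j}`
  have hx3 : x ^ (3 * d - 2) = y ^ ((3 : ℝ) / 2 - 1 / d) := by
    rw [hx, ← Real.rpow_natCast, ← Real.rpow_mul hy0.le]
    congr 1
    have hd0 : (0 : ℝ) < d := by exact_mod_cast hd1
    push_cast [Nat.cast_sub (show 2 ≤ 3 * d by omega)]
    field_simp
  have hexp : y ^ ((3 : ℝ) / 2 - 1 / 2 ^ j) ≤ y ^ ((3 : ℝ) / 2 - 1 / d) := by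
    refine Real.rpow_le_rpow_of_exponent_le hy1 ?_
    have hjd' : (2 : ℝ) ^ j ≤ d := by exact_mod_cast hjd
    have : (1 : ℝ) / d ≤ 1 / 2 ^ j := one_div_le_one_div_of_le (by positivity) hjd'
    linarith
  -- `y^e = q^e / (2C₁)^e ≥ q^e / (2C₁)^{3/2}`
  have hye : (q : ℝ) ^ ((3 : ℝ) / 2 - 1 / 2 ^ j) / (2 * C₁ : ℝ) ^ ((3 : ℝ) / 2) ≤ y ^ ((3 : ℝ) / 2 - 1 / 2 ^ j) := by
    rw [hy, Real.div_rpow hq0.le (by positivity)]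
    refine div_le_div_of_nonneg_left (by positivity) (by positivity) ?_
    refine Real.rpow_le_rpow_of_exponent_le ?_ ?_
    · have : (1 : ℝ) ≤ C₁ := by exact_mod_cast hC₁1
      linarith
    · have : (0 : ℝ) < 1 / 2 ^ j := by positivity
      linarith
  have h2pow : (2 : ℝ) ^ (d - 1) ≤ 2 ^ (D - 1) := pow_le_pow_right₀ (by norm_num) (by omega)
  -- combine
  have hq32 : (0 : ℝ) ≤ (q : ℝ) ^ ((3 : ℝ) / 2 - 1 / 2 ^ j) := Real.rpow_nonneg hq0.le _
  calc (((2 * C₁ : ℝ)) ^ ((3 : ℝ) / 2) * 2 ^ (D - 1))⁻¹ * (q : ℝ) ^ ((3 : ℝ) / 2 - 1 / 2 ^ j)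
      = ((q : ℝ) ^ ((3 : ℝ) / 2 - 1 / 2 ^ j) / (2 * C₁ : ℝ) ^ ((3 : ℝ) / 2)) / 2 ^ (D - 1) := by
        field_simp
    _ ≤ y ^ ((3 : ℝ) / 2 - 1 / 2 ^ j) / 2 ^ (D - 1) := by gcongr
    _ ≤ y ^ ((3 : ℝ) / 2 - 1 / d) / 2 ^ (d - 1) := by
        gcongr
    _ = x ^ (3 * d - 2) / 2 ^ (d - 1) := by rw [hx3]
    _ ≤ V.card := hcount

/-- **`∀ ε > 0`: tangency sets of size `c·q^{3/2−ε}` in `AG(2,q)` for EVERY sufficiently large prime `q`.**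
(`j` with `2^{−j} ≤ ε` in `exists_tangencySet_allPrimes`.) [this programme; method of Pohoata 2026 Prop. 5.1] -/
theorem exists_tangencySet_allPrimes_eps (ε : ℝ) (hε : 0 < ε) :
    ∃ c : ℝ, 0 < c ∧ ∃ q₀ : ℕ, ∀ q : ℕ, q.Prime → q₀ ≤ q →
      ∃ V : Finset (Fin 2 → ZMod q), c * (q : ℝ) ^ (3 / 2 - ε : ℝ) ≤ V.card ∧
        ∀ v ∈ V, ∃ u : Fin 2 → ZMod q, u ≠ 0 ∧ ∀ w ∈ V, u ⬝ᵥ w = u ⬝ᵥ v → w = v := by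
  -- `j` with `1/2^j ≤ ε`
  obtain ⟨j, hj⟩ : ∃ j : ℕ, (1 / 2 : ℝ) ^ j < ε := exists_pow_lt_of_lt_one hε (by norm_num)
  obtain ⟨c, hc, q₀, hall⟩ := exists_tangencySet_allPrimes j
  refine ⟨c, hc, q₀, fun q hq hq₀ => ?_⟩
  obtain ⟨V, hV, htan⟩ := hall q hq hq₀
  refine ⟨V, le_trans ?_ hV, htan⟩
  have hq1 : (1 : ℝ) ≤ q := by exact_mod_cast hq.one_lt.le
  refine mul_le_mul_of_nonneg_left (Real.rpow_le_rpow_of_exponent_le hq1 ?_) hc.le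
  rw [_root_.one_div_pow] at hj
  linarith

/-- **`stub_tangencySets` at exponent `3/2 − ε` for EVERY sufficiently large prime** (not only along a
positive-density set): for every `ε > 0` there are `c > 0` and `q₀` such that every prime `p ≥ q₀` carries a strong
representative system of `AG(2,p)` in the stub's exact flag format with at least `c · p^{3/2 − ε}` flags
(tangency set ⇒ flags by `FlagLine.TangencyHermitian.srs_of_tangencySet`, losing the factor `1 − 1/p ≥ 1/2`).  The
stub as registered is the case `ε = 0` along unboundedly many primes — open. [this programme] -/
theorem stubFormat_near_threeHalves_allPrimes (ε : ℝ) (hε : 0 < ε) :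
    ∃ c : ℝ, 0 < c ∧ ∃ q₀ : ℕ, ∀ p : ℕ, p.Prime → q₀ ≤ p →
      ∃ S : Finset ((Fin 2 → ZMod p) × (Fin 2 → ZMod p)),
        c * (p : ℝ) ^ (3 / 2 - ε : ℝ) ≤ S.card ∧
        ∀ f ∈ S, ∀ f' ∈ S, (dotProduct f.1 f'.2 = 1 ↔ f = f') := by
  classical
  obtain ⟨c, hc, q₀, hall⟩ := exists_tangencySet_allPrimes_eps ε hε
  refine ⟨c / 2, by positivity, q₀, fun p hp hq₀ => ?_⟩
  haveI : Fact p.Prime := ⟨hp⟩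
  obtain ⟨V, hV, htan⟩ := hall p hp hq₀
  choose! u hu using htan
  obtain ⟨S, hS, hsrs⟩ := FlagLine.TangencyHermitian.srs_of_tangencySet V u (fun v hv => (hu v hv).1)
    (fun v hv => (hu v hv).2)
  refine ⟨S, ?_, hsrs⟩
  have hp2 : (2 : ℝ) ≤ p := by exact_mod_cast hp.two_le
  have hS' : (V.card : ℝ) * p ≤ S.card * p + V.card := by
    have := hS
    rw [ZMod.card] at this
    exact_mod_cast this
  have hSV : (V.card : ℝ) ≤ 2 * S.card := by nlinarith
  calc c / 2 * (p : ℝ) ^ (3 / 2 - ε : ℝ) = (c * (p : ℝ) ^ (3 / 2 - ε : ℝ)) / 2 := by ring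
    _ ≤ V.card / 2 := by gcongr
    _ ≤ S.card := by linarith

end Summit.MatrixMultiplication.MatrixMultiplication.Theorems.LevelOneGL2Designs.Multiquadratic
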